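import Summits.NavierStokesRegularity.FluidComputer.PartialRegularityFace
import Literature.Analysis.FluidPDE.BarkerPrangeConcentrationHolds
import Literature.Analysis.FluidPDE.LerayHopfConcatenation
import HarnessLib

/-!
# Fluid computer — the level dictionary, TYPE-I CONCENTRATION FACE (L43): under a Type-I bound the critical mass
# concentrates at the parabolic scale around the focus (Barker–Prange)

HONEST FRAMING (cell `pub-fluidc`, verbatim): *low prior, high value-of-information experiment on Tao's
machine paradigm; NOT a claim that NS blows up.* Theorem side of the cell; nothing here is evidence of blow-up.
L33/L34/L36 say that around the focus `x₀` every FIXED ball carries unbounded critical mass in `limsup` and every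
parabolic cylinder an `ε` of space–time mass. Barker–Prange (Arch. Ration. Mech. Anal. 236 (2020), Thm. 2 —
PROVED in the tree as `BarkerPrange2020_thm2_holds`, with the viscosity explicit) sharpen this CONDITIONALLY: if
the solution obeys a TYPE-I bound in the scale-invariant Morrey form
`sup_{x̄} sup_{0<r<r₀} sup_{T−r²/ν<t<T} ‖u(t)‖_{L²(B_r(x̄))} ≤ M ν √r`, then the `L³` norm on the SHRINKING
parabolic balls `B(x₀, 2√(ν(T − t)/S(M)))` stays above an absolute `γν` for ALL late times — the critical mass
concentrates at the self-similar scale around the focus and never leaks out. Read on the dictionary's class (the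
maximal smooth solution agrees on `(0, T]` with a GLOBAL Leray–Hopf weak solution from `u 0`,
`IsLerayHopfOn.exists_isGlobalLerayHopf_extension`; every `(t, x)` with `t < T` is a regular point of it; the focus
of L33′ is a singular point of it, `PartialRegularityFace.isBackwardSingularPoint_of_unbounded`):

* `typeI_concentration` (**L43 — TYPE-I CONCENTRATION AT THE FOCUS**): there is an absolute `γ > 0`, and for every
  `M > 0` a scale factor `S = S(M) ∈ (0, 1/4]`, and for all `ν, T, r₀` a time `t_* < T` (`t_* = 0` if `r₀ = ∞`),
  such that for every maximal smooth Leray–Hopf solution on `[0, T)` obeying the Morrey Type-I bound with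
  `(M, r₀)` and every point `x₀` at which it is unbounded on every backward parabolic neighbourhood:
  `γν < ‖u(t)‖_{L³(B̄(x₀, 2√(ν(T−t)/S)))}` for every `t ∈ (t_*, T)`;
* `typeI_concentration_at_focus`: the same at the focus of L33′ (which exists).

Reading for the machine paradigm (words): a machine running at the minimal (Type-I / self-similar) rate keeps an
absolute amount `γν` of critical `L³` mass INSIDE the parabolic ball of radius `∼ √(ν(T − t))` around its focus at
all late times — the energy it hands upward in scale must stay spatially locked to the focus at the self-similar
rate; leakage out of the parabolic ball is incompatible with a Type-I blow-up. Conditional on the Type-I bound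
(which L40 excludes for axisymmetric designs); `γ`, `S(M)`, `t_*` inexplicit. Necessity only. 0 sorry; no new
definitions, no named facts.

## References

* T. Barker, C. Prange, *Localized smoothing for the Navier–Stokes equations and concentration of critical norms
  near singularities*, Arch. Ration. Mech. Anal. 236 (2020) 1487–1541 (arXiv:1812.09115), Thm. 2. [BarkerPrange2020]
* J. Leray, Acta Math. 63 (1934) 193–248, §31. [Leray1934]
-/

noncomputable section

open MeasureTheory Set Function Filter Topology Metric
open scoped ENNReal NNReal
open Literature.Analysis.FluidPDE Literature.Analysis.FunctionSpaces
open Summit.NavierStokesRegularity.FluidComputer.LocalisationFace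
open Summit.NavierStokesRegularity.FluidComputer.PartialRegularityFace

namespace Summit.NavierStokesRegularity.FluidComputer.TypeIConcentrationFace

/-- **The global Leray–Hopf continuation of a classical solution is regular before `T` and singular at the
focus.** For a classical solution `(u, p)` on `ℝ³ × [0, T)` (`T > 0`) and any `w` agreeing with `u` on `(0, T]`:
every `(t, x)` with `t ∈ (0, T)` is a regular point of `w` (continuity of `u` on a compact centred cylinder inside
the open slab), and a point `x₀` at which `u` is unbounded on every backward parabolic neighbourhood of `(T, x₀)`
makes `w` essentially unbounded on every backward cylinder `Q_r(T, x₀)`, `r² < T`. [folklore] -/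
theorem regular_and_singular_of_agree {ν T : ℝ}
    {u : ℝ → EuclideanSpace ℝ (Fin 3) → EuclideanSpace ℝ (Fin 3)} {p : ℝ → EuclideanSpace ℝ (Fin 3) → ℝ}
    (hcl : IsClassicalNSSolutionOn (Ico 0 T) ν 0 u p)
    {w : ℝ → EuclideanSpace ℝ (Fin 3) → EuclideanSpace ℝ (Fin 3)} (hw : ∀ t ∈ Ioc 0 T, w t = u t) :
    (∀ t ∈ Ioo 0 T, ∀ x : EuclideanSpace ℝ (Fin 3), IsRegularPoint w (t, x)) ∧
      ∀ x₀ : EuclideanSpace ℝ (Fin 3),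
        (∀ r : ℝ, 0 < r → ∀ M : ℝ, ∃ t ∈ Ioo (T - r ^ 2) T, 0 < t ∧ ∃ x ∈ ball x₀ r, M < ‖u t x‖) →
        ∀ r : ℝ, 0 < r → r ^ 2 < T →
          eLpNorm (uncurry w) ∞ (volume.restrict (parabolicCylinder r ((T : ℝ), x₀))) = ∞ := by
  have hcont : ContinuousOn (uncurry u) (Ico 0 T ×ˢ univ) := SereginSverak2002.continuousOn_uncurry hcl
  refine ⟨fun t ht x => ?_, fun x₀ hsing r hr hrT => ?_⟩
  · -- a centred cylinder at `(t, x)` inside the open slab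
    set δ : ℝ := min (t / 2) ((T - t) / 2) with hδ
    have hδpos : 0 < δ := lt_min (by linarith [ht.1]) (by linarith [ht.2])
    set r : ℝ := Real.sqrt δ with hrdef
    have hrpos : 0 < r := Real.sqrt_pos.2 hδpos
    have hr2 : r ^ 2 = δ := Real.sq_sqrt hδpos.le
    have hδt : δ ≤ t / 2 := min_le_left _ _
    have hδT : δ ≤ (T - t) / 2 := min_le_right _ _
    -- a bound for `u` on the compact closure
    set K : Set (ℝ × EuclideanSpace ℝ (Fin 3)) := Icc (t / 2) ((T + t) / 2) ×ˢ closedBall x r with hK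
    have hKc : IsCompact K := isCompact_Icc.prod (isCompact_closedBall _ _)
    have hKsub : K ⊆ Ico 0 T ×ˢ (univ : Set (EuclideanSpace ℝ (Fin 3))) := by
      rintro ⟨s, y⟩ ⟨⟨hs1, hs2⟩, -⟩
      exact ⟨⟨by linarith [ht.1], by linarith [ht.2]⟩, mem_univ _⟩
    obtain ⟨B, hB⟩ := hKc.exists_bound_of_continuousOn (hcont.mono hKsub)
    refine ⟨r, hrpos, ?_⟩
    rw [eLpNorm_exponent_top]
    refine eLpNormEssSup_lt_top_of_ae_bound (C := B) ?_
    rw [ae_restrict_iff' (isOpen_parabolicCylinderCentered _ _).measurableSet]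
    refine Eventually.of_forall fun z hz => ?_
    rw [mem_parabolicCylinderCentered] at hz
    have hz1 : z.1 ∈ Icc (t / 2) ((T + t) / 2) := by
      have h1 := hz.1.1
      have h2 := hz.1.2
      simp only at h1 h2
      constructor <;> nlinarith
    have hzK : z ∈ K := ⟨hz1, mem_closedBall.2 hz.2.le⟩
    have hzt : z.1 ∈ Ioc 0 T := ⟨by linarith [hz1.1, ht.1], by linarith [hz1.2, ht.2]⟩
    have e : uncurry w z = uncurry u z := by
      simp only [uncurry]
      rw [hw z.1 hzt]
    rw [e]
    exact hB z hzK
  · -- the focus: `w = u` on the backward cylinder, where `u` is essentially unbounded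
    have hsing' := isBackwardSingularPoint_of_unbounded hcl hsing r hr
    have hsub : parabolicCylinder r ((T : ℝ), x₀) ⊆ {z : ℝ × EuclideanSpace ℝ (Fin 3) | z.1 ∈ Ioc 0 T} := by
      intro z hz
      rw [mem_parabolicCylinder] at hz
      have h1 := hz.1.1
      simp only at h1
      exact ⟨by linarith, hz.1.2.le⟩
    have hae : (uncurry w) =ᵐ[volume.restrict (parabolicCylinder r ((T : ℝ), x₀))] uncurry u := by
      rw [Filter.EventuallyEq, ae_restrict_iff' (isOpen_parabolicCylinder _ _).measurableSet]
      refine Eventually.of_forall fun z hz => ?_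
      simp only [uncurry]
      rw [hw z.1 (hsub hz)]
    rw [eLpNorm_congr_ae hae]
    exact hsing'

/-- **L43 — TYPE-I CONCENTRATION AT A SINGULAR POINT (Barker–Prange 2020, Thm. 2, on the class).** There is an
absolute `γ > 0`, and for every `M > 0` a number `S ∈ (0, 1/4]`, such that for every `ν > 0`, `T > 0` and
`r₀ ∈ (0, ∞]` there is `t_* ∈ [0, T)` (`t_* = 0` if `r₀ = ∞`) with: for every maximal smooth solution `(u, p)` of the
unforced Navier–Stokes system on `ℝ³ × [0, T)`, Leray–Hopf from `u 0`, obeying the Morrey-type Type-I bound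
`‖u(t)‖_{L²(B_r(x̄))} ≤ M ν √r` for all `x̄`, `0 < r < r₀`, `max(0, T − r²/ν) < t < T`, and every point `x₀` at which
`u` is unbounded on every backward parabolic neighbourhood of `(T, x₀)`:
`γν < ‖u(t)‖_{L³(B̄(x₀, 2√(ν(T − t)/S)))}` for all `t ∈ (t_*, T)`.
[cite: BarkerPrange2020, Thm. 2 (arXiv:1812.09115, pp. 4–5)] [cite: Leray1934, §31] -/
theorem typeI_concentration :
    ∃ γ : ℝ, 0 < γ ∧ ∀ M : ℝ, 0 < M → ∃ S : ℝ, 0 < S ∧ S ≤ 1 / 4 ∧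
      ∀ (ν T : ℝ), 0 < ν → 0 < T → ∀ r₀ : ℝ≥0∞, 0 < r₀ →
        ∃ tStar : ℝ, 0 ≤ tStar ∧ tStar < T ∧ (r₀ = ∞ → tStar = 0) ∧
          ∀ (u : ℝ → EuclideanSpace ℝ (Fin 3) → EuclideanSpace ℝ (Fin 3))
            (p : ℝ → EuclideanSpace ℝ (Fin 3) → ℝ),
            IsMaximalSmoothSolution ν 0 u p T → IsLerayHopfOn T ν 0 (u 0) u →
            (∀ (y : EuclideanSpace ℝ (Fin 3)) (r : ℝ), 0 < r → ENNReal.ofReal r < r₀ →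
              ∀ t : ℝ, 0 < t → T - r ^ 2 / ν < t → t < T →
                eLpNorm (u t) 2 (volume.restrict (ball y r)) ≤ ENNReal.ofReal (M * ν * Real.sqrt r)) →
            ∀ x₀ : EuclideanSpace ℝ (Fin 3),
              (∀ r : ℝ, 0 < r → ∀ K : ℝ, ∃ t ∈ Ioo (T - r ^ 2) T, 0 < t ∧ ∃ x ∈ ball x₀ r, K < ‖u t x‖) →
              ∀ t ∈ Ioo tStar T,
                ENNReal.ofReal (γ * ν) <
                  eLpNorm (u t) 3 (volume.restrict (closedBall x₀ (2 * Real.sqrt (ν * (T - t) / S)))) := by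
  obtain ⟨γ, hγ, H⟩ := BarkerPrange2020_thm2_holds
  refine ⟨γ, hγ, fun M hM => ?_⟩
  obtain ⟨S, hS, hS4, HS⟩ := H M hM
  refine ⟨S, hS, hS4, fun ν T hν hT r₀ hr₀ => ?_⟩
  obtain ⟨tStar, ht0, htT, htop, Hu⟩ := HS ν T hν hT r₀ hr₀
  refine ⟨tStar, ht0, htT, htop, fun u p hmax hLH hMorrey x₀ hsing t ht => ?_⟩
  -- the global Leray–Hopf continuation `w` of `u`
  obtain ⟨w, hw, hwu⟩ := hLH.exists_isGlobalLerayHopf_extension hν hT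
  obtain ⟨hreg, hsingw⟩ := regular_and_singular_of_agree hmax.1 hwu
  -- the Morrey bound transfers to `w` (times in `(0, T)`)
  have hMorrey' : ∀ (y : EuclideanSpace ℝ (Fin 3)) (r : ℝ), 0 < r → ENNReal.ofReal r < r₀ →
      ∀ s : ℝ, 0 < s → T - r ^ 2 / ν < s → s < T →
        eLpNorm (w s) 2 (volume.restrict (ball y r)) ≤ ENNReal.ofReal (M * ν * Real.sqrt r) := by
    intro y r hr hrr₀ s hs0 hs1 hs2
    rw [hwu s ⟨hs0, hs2.le⟩]
    exact hMorrey y r hr hrr₀ s hs0 hs1 hs2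
  have key := Hu (u 0) w hw hMorrey' hreg x₀ (hsingw x₀ hsing) t ht
  have htI : t ∈ Ioc 0 T := ⟨ht0.trans_lt ht.1, ht.2.le⟩
  rw [hwu t htI] at key
  exact key

/-- **L43 at the focus of L33′.** With the same `γ`, `S(M)` and `t_*(ν, T, M, r₀)`: every maximal smooth
Leray–Hopf solution on `[0, T)` obeying the Morrey Type-I bound has a point `x₀` (a singular point) with
`γν < ‖u(t)‖_{L³(B̄(x₀, 2√(ν(T − t)/S)))}` for all `t ∈ (t_*, T)`.
[cite: BarkerPrange2020, Thm. 2 (arXiv:1812.09115, pp. 4–5)] -/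
theorem typeI_concentration_at_focus :
    ∃ γ : ℝ, 0 < γ ∧ ∀ M : ℝ, 0 < M → ∃ S : ℝ, 0 < S ∧ S ≤ 1 / 4 ∧
      ∀ (ν T : ℝ), 0 < ν → 0 < T → ∀ r₀ : ℝ≥0∞, 0 < r₀ →
        ∃ tStar : ℝ, 0 ≤ tStar ∧ tStar < T ∧ (r₀ = ∞ → tStar = 0) ∧
          ∀ (u : ℝ → EuclideanSpace ℝ (Fin 3) → EuclideanSpace ℝ (Fin 3))
            (p : ℝ → EuclideanSpace ℝ (Fin 3) → ℝ),
            IsMaximalSmoothSolution ν 0 u p T → IsLerayHopfOn T ν 0 (u 0) u →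
            (∀ (y : EuclideanSpace ℝ (Fin 3)) (r : ℝ), 0 < r → ENNReal.ofReal r < r₀ →
              ∀ t : ℝ, 0 < t → T - r ^ 2 / ν < t → t < T →
                eLpNorm (u t) 2 (volume.restrict (ball y r)) ≤ ENNReal.ofReal (M * ν * Real.sqrt r)) →
            ∃ x₀ : EuclideanSpace ℝ (Fin 3),
              (∀ r : ℝ, 0 < r → ∀ K : ℝ, ∃ t ∈ Ioo (T - r ^ 2) T, 0 < t ∧ ∃ x ∈ ball x₀ r, K < ‖u t x‖) ∧
              ∀ t ∈ Ioo tStar T,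
                ENNReal.ofReal (γ * ν) <
                  eLpNorm (u t) 3 (volume.restrict (closedBall x₀ (2 * Real.sqrt (ν * (T - t) / S)))) := by
  obtain ⟨γ, hγ, H⟩ := typeI_concentration
  refine ⟨γ, hγ, fun M hM => ?_⟩
  obtain ⟨S, hS, hS4, HS⟩ := H M hM
  refine ⟨S, hS, hS4, fun ν T hν hT r₀ hr₀ => ?_⟩
  obtain ⟨tStar, ht0, htT, htop, Hu⟩ := HS ν T hν hT r₀ hr₀
  refine ⟨tStar, ht0, htT, htop, fun u p hmax hLH hMorrey => ?_⟩
  obtain ⟨x₀, hsing⟩ := exists_singularPoint hν hT hmax hLH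
  exact ⟨x₀, hsing, Hu u p hmax hLH hMorrey x₀ hsing⟩

end Summit.NavierStokesRegularity.FluidComputer.TypeIConcentrationFace

end
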